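import Summits.PneNP.PneNP.Theorems.SoloBlindSliceMID

/-!
# The slice automaticity of MID is exactly `⌊N/2⌋ + 1` (upper bound: the phase gadget)

Companion to `SoloBlindSliceMID` (the lower bound `card_of_sliceCorrectMID`: every automaton
correct on the length-`N` slice of `MID = {x : the ⌈|x|/2⌉-th symbol of x is 1}` has at least
`⌊N/2⌋ + 1` states).  Here: for every `N ≥ 4` an automaton with exactly `⌊N/2⌋ + 1` states IS
correct on that slice (`exists_sliceCorrectMID`), so the slice automaticity is `γ_MID(N) = ⌊N/2⌋ + 1`
(`sliceAutomaticity_MID`).  The automaton is a PHASE GADGET: states `0, 1, …` count the prefix, so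
that the automaton sits in a fixed state exactly when it reads the decisive symbol, and that read
shifts the PHASE of the counting cycle (`nxOdd` for odd `N`, accepting states `{0,1}`; `nxEven` with
one extra state for even `N`, accepting state `n-1`).  It was found by exhaustive search at
`N = 7, 8` and generalised; the naive counter-with-sinks automaton has one state more.
Context: PROPOSITION 3.9 (iii) of the soloist report (calibration of the all-device edge of the
one-pass window; nothing on the summit line).
-/

namespace Summit.PneNP.PneNP.Theorems.SoloBlind

open Function Finset

section SliceMIDGadget

/-! ### The phase gadget: `⌊N/2⌋ + 1` states suffice for every `N ≥ 4`

States `0, 1, …, m-1` count the prefix, so that the automaton sits in state `m-1` exactly when it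
reads the decisive symbol, and that read SHIFTS THE PHASE of the counting cycle; one extra state
is needed for even `N`.  Found by the exhaustive search at `N = 7, 8` and generalised. -/

/-- Runs of an `ℕ`-valued transition table. -/
def runN (nx : ℕ → Bool → ℕ) (v : ℕ) (w : List Bool) : ℕ := w.foldl nx v

/-- The `ℕ`-run on the empty word. -/
@[simp] theorem runN_nil (nx : ℕ → Bool → ℕ) (v : ℕ) : runN nx v [] = v := rfl

/-- The `ℕ`-run on `b :: w`. -/
@[simp] theorem runN_cons (nx : ℕ → Bool → ℕ) (v : ℕ) (b : Bool) (w : List Bool) :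
    runN nx v (b :: w) = runN nx (nx v b) w := rfl

/-- The `ℕ`-run on a concatenation. -/
theorem runN_append (nx : ℕ → Bool → ℕ) (v : ℕ) (u w : List Bool) :
    runN nx v (u ++ w) = runN nx (runN nx v u) w := List.foldl_append

/-- Counting: while every step is `+1`, the run adds the length. -/
theorem runN_count (nx : ℕ → Bool → ℕ) (w : List Bool) :
    ∀ v : ℕ, (∀ v', v ≤ v' → v' < v + w.length → ∀ b, nx v' b = v' + 1) →
      runN nx v w = v + w.length := by
  induction w with
  | nil => intro v _; simp
  | cons b w ih =>
    intro v h
    have hb : nx v b = v + 1 := h v le_rfl (by simp) b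
    rw [runN_cons, hb, ih (v + 1)]
    · simp only [List.length_cons]; omega
    · intro v' h1 h2 b'
      refine h v' (by omega) ?_ b'
      simp only [List.length_cons]; omega

/-- A transition table on `Fin (n+1)` from an `ℕ`-valued one that stays `≤ n`. -/
def finTable (n : ℕ) (nx : ℕ → Bool → ℕ) (h : ∀ v b, nx v b ≤ n) :
    Fin (n + 1) → Bool → Fin (n + 1) :=
  fun i b => ⟨nx i.val b, Nat.lt_succ_of_le (h i.val b)⟩

/-- The run of the lifted table is the `ℕ`-run on values. -/
theorem run_finTable_val (n : ℕ) (nx : ℕ → Bool → ℕ) (h : ∀ v b, nx v b ≤ n)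
    (i : Fin (n + 1)) (w : List Bool) :
    (run (finTable n nx h) i w).val = runN nx i.val w := by
  induction w generalizing i with
  | nil => rfl
  | cons b w ih => rw [run_cons, runN_cons, ih]; rfl

/-- A word of length `k + 1` splits off its last symbol. -/
theorem exists_eq_append_singleton {w : List Bool} {k : ℕ} (hw : w.length = k + 1) :
    ∃ y : List Bool, ∃ c : Bool, w = y ++ [c] ∧ y.length = k := by
  have hne : w ≠ [] := by rintro rfl; simp at hw
  refine ⟨w.dropLast, w.getLast hne, (List.dropLast_append_getLast hne).symm, ?_⟩
  rw [List.length_dropLast, hw]; rfl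

/-- The odd gadget (`N = 2n+1`, states `0..n`): count up to `n`; at `n` read `1 ↦ 1`, `0 ↦ 0`. -/
def nxOdd (n : ℕ) (v : ℕ) (b : Bool) : ℕ := if v < n then v + 1 else if b then 1 else 0

/-- The odd gadget stays in `0..n`. -/
theorem nxOdd_le {n : ℕ} (hn : 1 ≤ n) : ∀ v b, nxOdd n v b ≤ n := by
  intro v b
  unfold nxOdd
  split_ifs <;> omega

/-- The odd gadget is correct on the slice: `N = 2n + 1`, `n ≥ 2`, accepting states `{0, 1}`. -/
theorem sliceCorrectMID_odd (N : ℕ) (hN : N = 2 * (N / 2) + 1) (hn : 2 ≤ N / 2) :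
    SliceCorrectMID (finTable (N / 2) (nxOdd (N / 2)) (nxOdd_le (by omega)))
      (0 : Fin (N / 2 + 1)) {i | i.val ≤ 1} N := by
  set n := N / 2 with hndef
  intro x hx
  have hidx : (N + 1) / 2 - 1 = n := by omega
  have hnlt : n < x.length := by omega
  have hdec : x = x.take n ++ x.getD n false :: x.drop (n + 1) := by
    rw [List.getD_eq_getElem _ _ hnlt, ← List.drop_eq_getElem_cons hnlt, List.take_append_drop]
  have htake : runN (nxOdd n) (↑(0 : Fin (n + 1))) (x.take n) = n := by
    rw [runN_count]
    · simp; omega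
    · intro v' _ h2 b
      simp at h2
      unfold nxOdd; rw [if_pos (by omega)]
  have htail : (x.drop (n + 1)).length = n := by simp; omega
  rw [hidx, Set.mem_setOf_eq, run_finTable_val]
  cases hb : x.getD n false
  · -- decisive symbol 0: the run returns to 0, counts to n ≥ 2 and rejects
    rw [hb] at hdec
    have h0 : nxOdd n n false = 0 := by unfold nxOdd; simp
    rw [hdec, runN_append, runN_cons, htake, h0, runN_count]
    · simp; omega
    · intro v' _ h2 b
      rw [htail] at h2
      unfold nxOdd; rw [if_pos (by omega)]
  · -- decisive symbol 1: the run continues from 1, is at n before the last symbol, ends in {0,1}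
    rw [hb] at hdec
    have h1 : nxOdd n n true = 1 := by unfold nxOdd; simp
    obtain ⟨y, c, hyc, hy⟩ := exists_eq_append_singleton (k := n - 1) (by rw [htail]; omega)
    rw [hdec, runN_append, runN_cons, htake, h1, hyc, runN_append, runN_count _ y, runN_cons,
      runN_nil]
    · have : nxOdd n (1 + y.length) c ≤ 1 := by
        unfold nxOdd; rw [if_neg (by omega)]; split <;> omega
      simpa using this
    · intro v' _ h2 b
      unfold nxOdd; rw [if_pos (by omega)]

/-- The even gadget (`N = 2n`, states `0..n`): count up to `n-1`; there read `1 ↦ n`, `0 ↦ 0`;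
state `n` returns to `0`. -/
def nxEven (n : ℕ) (v : ℕ) (b : Bool) : ℕ :=
  if v + 1 < n then v + 1 else if v + 1 = n then (if b then n else 0) else 0

/-- The even gadget stays in `0..n`. -/
theorem nxEven_le (n : ℕ) : ∀ v b, nxEven n v b ≤ n := by
  intro v b
  unfold nxEven
  split_ifs <;> omega

/-- The even gadget is correct on the slice: `N = 2n`, `n ≥ 2`, accepting state `n - 1`. -/
theorem sliceCorrectMID_even (N : ℕ) (hN : N = 2 * (N / 2)) (hn : 2 ≤ N / 2) :
    SliceCorrectMID (finTable (N / 2) (nxEven (N / 2)) (nxEven_le _))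
      (0 : Fin (N / 2 + 1)) {i | i.val + 1 = N / 2} N := by
  set n := N / 2 with hndef
  intro x hx
  have hidx : (N + 1) / 2 - 1 = n - 1 := by omega
  have hnlt : n - 1 < x.length := by omega
  have hdec : x = x.take (n - 1) ++ x.getD (n - 1) false :: x.drop (n - 1 + 1) := by
    rw [List.getD_eq_getElem _ _ hnlt, ← List.drop_eq_getElem_cons hnlt, List.take_append_drop]
  have htake : runN (nxEven n) (↑(0 : Fin (n + 1))) (x.take (n - 1)) = n - 1 := by
    rw [runN_count]
    · simp; omega
    · intro v' _ h2 b
      simp at h2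
      unfold nxEven; rw [if_pos (by omega)]
  have htail : (x.drop (n - 1 + 1)).length = n := by simp; omega
  rw [hidx, Set.mem_setOf_eq, run_finTable_val]
  cases hb : x.getD (n - 1) false
  · -- decisive symbol 0: back to 0, at n-1 before the last symbol, which leads to n or 0 ≠ n-1
    rw [hb] at hdec
    have h0 : nxEven n (n - 1) false = 0 := by
      unfold nxEven; rw [if_neg (by omega), if_pos (by omega)]; simp
    obtain ⟨y, c, hyc, hy⟩ := exists_eq_append_singleton (k := n - 1) (by rw [htail]; omega)
    rw [hdec, runN_append, runN_cons, htake, h0, hyc, runN_append, runN_count _ y, runN_cons,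
      runN_nil]
    · have : nxEven n (0 + y.length) c + 1 ≠ n := by
        unfold nxEven; rw [if_neg (by omega), if_pos (by omega)]; split <;> omega
      simpa using this
    · intro v' _ h2 b
      unfold nxEven; rw [if_pos (by omega)]
  · -- decisive symbol 1: to the extra state n, then 0, then count to n-1: accept
    rw [hb] at hdec
    have h1 : nxEven n (n - 1) true = n := by
      unfold nxEven; rw [if_neg (by omega), if_pos (by omega)]; simp
    have hnlt' : n - 1 + 1 < x.length := by omega
    have h2 : nxEven n n (x[n - 1 + 1]) = 0 := by
      unfold nxEven; rw [if_neg (by omega), if_neg (by omega)]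
    rw [hdec, runN_append, runN_cons, htake, h1, List.drop_eq_getElem_cons hnlt', runN_cons, h2,
      runN_count]
    · simp; omega
    · intro v' _ h3 b
      simp at h3
      unfold nxEven; rw [if_pos (by omega)]

/-- THEOREM (slice automaticity of MID, upper bound).  For every `N ≥ 4` some automaton with
`⌊N/2⌋ + 1` states is correct on the length-`N` slice of `MID`; with `card_of_sliceCorrectMID`,
`γ_MID(N) = ⌊N/2⌋ + 1` exactly. -/
theorem exists_sliceCorrectMID {N : ℕ} (hN : 4 ≤ N) :
    ∃ (δ' : Fin (N / 2 + 1) → Bool → Fin (N / 2 + 1)) (q₀ : Fin (N / 2 + 1))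
      (F : Set (Fin (N / 2 + 1))), SliceCorrectMID δ' q₀ F N := by
  by_cases h : N % 2 = 0
  · exact ⟨_, _, _, sliceCorrectMID_even N (by omega) (by omega)⟩
  · exact ⟨_, _, _, sliceCorrectMID_odd N (by omega) (by omega)⟩

/-- The two bounds together: `⌊N/2⌋ + 1` is the least number of states of an automaton correct on
the length-`N` slice of `MID`, for every `N ≥ 4`. -/
theorem sliceAutomaticity_MID {N : ℕ} (hN : 4 ≤ N) :
    (∃ (δ' : Fin (N / 2 + 1) → Bool → Fin (N / 2 + 1)) (q₀ : Fin (N / 2 + 1))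
      (F : Set (Fin (N / 2 + 1))), SliceCorrectMID δ' q₀ F N) ∧
    (∀ (τ : Type) [Fintype τ] (δ' : τ → Bool → τ) (q₀ : τ) (F : Set τ),
      SliceCorrectMID δ' q₀ F N → N / 2 + 1 ≤ Fintype.card τ) :=
  ⟨exists_sliceCorrectMID hN, fun _ _ _ _ _ h => card_of_sliceCorrectMID h⟩

end SliceMIDGadget

end Summit.PneNP.PneNP.Theorems.SoloBlind
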